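import Literature.Analysis.FluidPDE.Grujic2013SparsenessRegularityCriterion
import Literature.Analysis.FluidPDE.NSAnalyticityRadiusLinftyProofs
import Literature.Analysis.FluidPDE.NSBoundedMildOseenRestart
import Literature.Analysis.FluidPDE.NSBoundedMildOseenDuhamel
import Literature.Analysis.FluidPDE.ForcedOseenRepresentationClassical
import Literature.Analysis.FluidPDE.NSLerayStrongLocalExistence
import Literature.Analysis.FluidPDE.SolenoidalL2Duality
import Literature.Analysis.FluidPDE.KatoUniqueness
import HarnessLib

/-!
# Grujić 2013, Theorem 3.1 in restart form holds for mild solutions: the hypothesis schema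
# `Grujic2013.HasAnalyticRestarts` discharged from Guberović's analyticity radius

Analysis/FluidPDE proof file (theorems only: no definition, no named fact, no `sorry`).

`Grujic2013SparsenessRegularityCriterion.lean` records Grujić's geometric-measure criterion
(Z. Grujić, Nonlinearity **26** (2013) 289–296 = arXiv:1111.0217, Thm. 4.1) as the named fact
`grujic2013_sparseness_regularity_velocity`, whose proof in print uses the Navier–Stokes equations
ONLY through **Theorem 3.1** there (= Guberović 2010: for `u₀ ∈ L^∞`, the mild solution is, for
`t ≤ 1/(c₀²‖u₀‖_∞²)`, the restriction of a function holomorphic in the tube of radius `c₀⁻¹√t`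
and bounded by `c₀‖u₀‖_∞`, "`c₀ > 1` an absolute constant", p. 6), restarted at the times
`t₀, s₀ = t₁, s₁, …` of the proof of Theorem 4.1 (p. 7). The statement file therefore carries that
restart property as an explicit hypothesis schema `Grujic2013.HasAnalyticRestarts c₀ ν T u` and
notes "for the mild solution of the printed class it is supplied, with Guberović's absolute `c₀`,
by the tree theorem `guberovic2010_analyticity_radius_holds` and `L^∞` mild uniqueness". This
file PROVES that supply, so that the schema is not an extra assumption for the solutions the
source has in mind:

* `Grujic2013.hasAnalyticRestarts_of_oseenMild` — there is `c₀ > 1` (Guberović's constant, the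
  one of `guberovic2010_analyticity_radius_holds`) such that every bounded Oseen-mild solution on
  `(0, T)` — `u(t) = e^{νtΔ}u(0) − B^ν_0(u,u)(t)` a.e. for `t ∈ (0,T)`, from a bounded, weakly
  divergence-free datum `u(0)`, jointly measurable, with continuous slices bounded by one
  constant on `[0, T)` (Grujić, Remark 3.1: "the mild solution, i.e. the solution of Oseen's
  integral equation") — satisfies `Grujic2013.HasAnalyticRestarts c₀ ν T u`. Proof: restart of the
  integral equation at `t` (KNSS 2009 §4, tree theorem `oseenMild_restart_holds`), weak
  divergence-freeness of the slice `u(t)` (`isWeaklyDivFree_slice_of_oseenMild`: the caloric and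
  the Duhamel term are weakly divergence free), and Guberović's theorem transported to any bounded
  continuous solution of Oseen's equation by `L^∞` uniqueness
  (`guberovic2010_analyticity_radius.of_oseen_solution`), with `M = ‖u(t)‖_∞ = ⨆ₓ ‖u(t,x)‖`.
* `Grujic2013.hasAnalyticRestarts_of_classical` — the same constant serves every classical
  unforced solution on `ℝ³ × (0, T)` (the frame of the named fact) which is bounded and of finite
  energy on every compact sub-slab `[a, b] × ℝ³ ⊂ (0, T) × ℝ³` (e.g. a Leray solution regular on
  `(0, T)`): by the tree's `IsClassicalNSSolutionOn.ae_eq_forced_oseenMild` (with zero force) the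
  time-translate `u(· + t)` solves Oseen's equation from the datum `u(t)` on `[0, b − t]`, and
  Guberović's theorem applies from the base time.

No regularity claim about Navier–Stokes is made here; these are properties of the PRINTED class.

## References

* Z. Grujić, Nonlinearity 26 (2013) 289–296 = arXiv:1111.0217: Thm. 3.1 and Remark 3.1 (p. 6),
  proof of Thm. 4.1 (p. 7: restarts at `t₀`, `s₀`, …). [Grujic2012]
* R. Guberović, Discrete Contin. Dyn. Syst. 27 (2010) 231–277 (the `L^∞` analyticity radius; tree
  fact `guberovic2010_analyticity_radius`, PROVED `guberovic2010_analyticity_radius_holds`).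
  [Guberovic2010]
* G. Koch, N. Nadirashvili, G. Seregin, V. Šverák, Acta Math. 203 (2009) = arXiv:0709.3599, §4
  (restart of the integral equation; tree `oseenMild_restart_holds`).
  [KochNadirashviliSereginSverak2009]
* P. G. Lemarié-Rieusset, *The Navier–Stokes Problem in the 21st Century* (2016), Thm. 6.1 with
  Prop. 6.5 (classical finite-energy solutions are Oseen-mild; tree
  `IsClassicalNSSolutionOn.ae_eq_forced_oseenMild`). [LemarieRieusset2016]
-/

noncomputable section

open MeasureTheory Set Function Filter Metric
open _root_.Topology
open scoped ENNReal NNReal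

namespace Literature.Analysis.FluidPDE

/-! ### Two small tools -/

/-- A pointwise bound gives the `L^∞` bound. [folklore] -/
private theorem eLpNorm_top_le_of_forall_norm_le
    {f : EuclideanSpace ℝ (Fin 3) → EuclideanSpace ℝ (Fin 3)} {C : ℝ} (h : ∀ x, ‖f x‖ ≤ C) :
    eLpNorm f ∞ volume ≤ ENNReal.ofReal C := by
  rw [eLpNorm_exponent_top]
  exact eLpNormEssSup_le_of_ae_bound (Eventually.of_forall h)

/-- **The slices of a bounded Oseen-mild solution from a weakly divergence-free datum are weakly
divergence free**: `u(t) = e^{νtΔ}u(0) − B^ν_0(u,u)(t)` a.e., both terms being bounded and weakly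
divergence free (`IsWeaklyDivFree.heatExtension_of_bound`, `isWeaklyDivFree_oseenDuhamel`), and
the weak constraint only sees the a.e. class. [cite: KochNadirashviliSereginSverak2009, §4 (i) (arXiv:0709.3599 p. 8)] -/
theorem isWeaklyDivFree_slice_of_oseenMild {ν T M : ℝ} (hν : 0 < ν)
    {u : ℝ → EuclideanSpace ℝ (Fin 3) → EuclideanSpace ℝ (Fin 3)}
    (hum : AEStronglyMeasurable (uncurry u)
      ((volume : Measure (ℝ × EuclideanSpace ℝ (Fin 3))).restrict (Ioo 0 T ×ˢ univ)))
    (hu0 : AEStronglyMeasurable (u 0) volume) (hdiv0 : IsWeaklyDivFree (u 0))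
    (hM : ∀ t ∈ Ico 0 T, ∀ x, ‖u t x‖ ≤ M)
    (hmild : ∀ t ∈ Ioo 0 T, u t =ᵐ[volume] fun x =>
      UnboundedOperators.heatExtension (u 0) (ν * t) x - oseenDuhamel ν 0 u u t x)
    {t : ℝ} (ht : t ∈ Ioo 0 T) : IsWeaklyDivFree (u t) := by
  have hT : 0 < T := ht.1.trans ht.2
  have h0I : (0 : ℝ) ∈ Ico 0 T := ⟨le_rfl, hT⟩
  have hM0 : 0 ≤ M := (norm_nonneg _).trans (hM 0 h0I 0)
  have hνt : 0 < ν * t := mul_pos hν ht.1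
  have hM' : ∀ τ ∈ Ioo 0 T, ∀ y, ‖u τ y‖ ≤ M := fun τ hτ y => hM τ ⟨hτ.1.le, hτ.2⟩ y
  set h : EuclideanSpace ℝ (Fin 3) → EuclideanSpace ℝ (Fin 3) :=
    UnboundedOperators.heatExtension (u 0) (ν * t) with hh
  set Bt : EuclideanSpace ℝ (Fin 3) → EuclideanSpace ℝ (Fin 3) := oseenDuhamel ν 0 u u t with hBt
  -- the caloric term: continuous, bounded, weakly divergence free
  have h0m : MemLp (u 0) ∞ (volume : Measure (EuclideanSpace ℝ (Fin 3))) :=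
    memLp_top_of_bound hu0 M (Eventually.of_forall (hM 0 h0I))
  have hh_cont : Continuous h :=
    (UnboundedOperators.contDiff_heatExtension_holds h0m le_top hνt).continuous
  have hh_bd : ∀ x, ‖h x‖ ≤ M := fun x => UnboundedOperators.norm_heatExtension_le (hM 0 h0I) hνt x
  have hh_m : MemLp h ∞ (volume : Measure (EuclideanSpace ℝ (Fin 3))) :=
    memLp_top_of_bound hh_cont.aestronglyMeasurable M (Eventually.of_forall hh_bd)
  have hdivh : IsWeaklyDivFree h := hdiv0.heatExtension_of_bound hu0 (hM 0 h0I) hνt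
  -- the Duhamel term: measurable, bounded, weakly divergence free
  obtain ⟨CB, _, hCBle⟩ := exists_norm_oseenDuhamel_bounded_le (E := EuclideanSpace ℝ (Fin 3))
  have hBt_bd : ∀ x, ‖Bt x‖ ≤ CB * M ^ 2 * ν ^ (-(1 / 2 : ℝ)) * (2 * Real.sqrt (t - 0)) := fun x =>
    hCBle hν ht.1 hM0 (fun τ hτ y => hM' τ ⟨hτ.1, hτ.2.trans ht.2⟩ y)
      (fun τ hτ y => hM' τ ⟨hτ.1, hτ.2.trans ht.2⟩ y) x
  have hBt_meas : AEStronglyMeasurable Bt (volume : Measure (EuclideanSpace ℝ (Fin 3))) :=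
    aestronglyMeasurable_oseenDuhamel hν hum hum hM0 hM' hM' ht.1 ht.2.le
  have hBt_m : MemLp Bt ∞ (volume : Measure (EuclideanSpace ℝ (Fin 3))) :=
    memLp_top_of_bound hBt_meas _ (Eventually.of_forall hBt_bd)
  have hdivB : IsWeaklyDivFree Bt := isWeaklyDivFree_oseenDuhamel hν hum hum hM0 hM' hM' ht.1 ht.2.le
  -- the difference, and the a.e. class of `u t`
  have hsub : IsWeaklyDivFree (h - Bt) := IsWeaklyDivFree.sub le_top hdivh hdivB hh_m hBt_m
  refine hsub.congr_ae ?_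
  filter_upwards [hmild t ht] with x hx
  rw [Pi.sub_apply, hx]

namespace Grujic2013

/-! ### The schema for bounded Oseen-mild solutions -/

/-- **Grujić 2013, Theorem 3.1 in restart form, for bounded mild solutions** (Remark 3.1: the mild
solution = the solution of Oseen's integral equation). There is an absolute constant `c₀ > 1`
(Guberović's) such that every bounded Oseen-mild solution `u` on `(0, T)` from a bounded, weakly
divergence-free datum `u(0)` — jointly measurable, continuous slices, `‖u(t,x)‖ ≤ M` on `[0,T)`,
`u(t) = e^{νtΔ}u(0) − B^ν_0(u,u)(t)` a.e. for `t ∈ (0,T)` — has the analytic restarts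
`Grujic2013.HasAnalyticRestarts c₀ ν T u`: for `0 < t < s < T` with `s < t + ν/(c₀²‖u(t)‖_∞²)`,
`u(s)` is the restriction of a map holomorphic on the tube of radius `c₀⁻¹√(ν(s−t))`, bounded
there by `c₀‖u(t)‖_∞`. [cite: Grujic2012, Thm. 3.1 and Rmk. 3.1 (arXiv:1111.0217 p. 6), proof of Thm. 4.1 (p. 7); KochNadirashviliSereginSverak2009, §4 (restart)] -/
theorem hasAnalyticRestarts_of_oseenMild :
    ∃ c₀ : ℝ, 1 < c₀ ∧ ∀ ⦃ν T M : ℝ⦄, 0 < ν → 0 < T →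
      ∀ ⦃u : ℝ → EuclideanSpace ℝ (Fin 3) → EuclideanSpace ℝ (Fin 3)⦄,
        AEStronglyMeasurable (uncurry u)
          ((volume : Measure (ℝ × EuclideanSpace ℝ (Fin 3))).restrict (Ioo 0 T ×ˢ univ)) →
        AEStronglyMeasurable (u 0) volume → IsWeaklyDivFree (u 0) →
        (∀ t ∈ Ico 0 T, ∀ x, ‖u t x‖ ≤ M) →
        (∀ t ∈ Ioo 0 T, Continuous (u t)) →
        (∀ t ∈ Ioo 0 T, u t =ᵐ[volume] fun x =>
          UnboundedOperators.heatExtension (u 0) (ν * t) x - oseenDuhamel ν 0 u u t x) →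
        Grujic2013.HasAnalyticRestarts c₀ ν T u := by
  obtain ⟨c₀, hc₀, hG⟩ := guberovic2010_analyticity_radius_holds.of_oseen_solution
  refine ⟨c₀, hc₀, ?_⟩
  intro ν T M hν hT u hum hu0 hdiv0 hM hcont hmild t ht s hs hwin
  have hM0 : 0 ≤ M := (norm_nonneg _).trans (hM 0 ⟨le_rfl, hT⟩ 0)
  -- `N = ‖u(t)‖_∞ = ⨆ₓ ‖u(t,x)‖`
  have hbdd : BddAbove (Set.range fun x => ‖u t x‖) := by
    refine ⟨M, ?_⟩
    rintro _ ⟨x, rfl⟩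
    exact hM t ⟨ht.1.le, ht.2⟩ x
  have hN : ∀ x, ‖u t x‖ ≤ ⨆ y, ‖u t y‖ := fun x => le_ciSup hbdd x
  have hN0 : 0 ≤ ⨆ y, ‖u t y‖ := Real.iSup_nonneg fun y => norm_nonneg _
  rcases hN0.eq_or_lt with hz | hNpos
  · -- `‖u(t)‖_∞ = 0`: the window `(t, t + ν/(c₀² · 0))` is empty
    exfalso
    rw [← hz] at hwin
    simp at hwin
    linarith [hs.1]
  -- restart of the integral equation at `t`
  have hbd : ∀ T₁ ∈ Ioo 0 T, ∃ C : ℝ≥0∞, C < ∞ ∧ ∀ τ ∈ Ico 0 T₁, eLpNorm (u τ) ∞ volume ≤ C :=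
    fun T₁ hT₁ => ⟨ENNReal.ofReal M, ENNReal.ofReal_lt_top, fun τ hτ =>
      eLpNorm_top_le_of_forall_norm_le (hM τ ⟨hτ.1, hτ.2.trans hT₁.2⟩)⟩
  have hrestart : ∀ ⦃τ : ℝ⦄, t < τ → τ < T → u τ =ᵐ[volume] fun x =>
      UnboundedOperators.heatExtension (u t) (ν * (τ - t)) x - oseenDuhamel ν t u u τ x :=
    fun τ htτ hτT => oseenMild_restart_holds (EuclideanSpace ℝ (Fin 3)) hν hT hum hu0 hbd hmild
      ht.1 htτ hτT
  -- the window slab `(t, T₁)`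
  set T₁ : ℝ := min T (t + ν / (c₀ ^ 2 * (⨆ y, ‖u t y‖) ^ 2)) with hT₁
  have hsT₁ : s < T₁ := lt_min hs.2 hwin
  have htT₁ : t < T₁ := hs.1.trans hsT₁
  have hT₁le : T₁ ≤ t + ν / (c₀ ^ 2 * (⨆ y, ‖u t y‖) ^ 2) := min_le_right _ _
  have hT₁T : T₁ ≤ T := min_le_left _ _
  have ha : AEStronglyMeasurable (u t) volume := (hcont t ht).aestronglyMeasurable
  have haN : eLpNorm (u t) ∞ volume ≤ ENNReal.ofReal (⨆ y, ‖u t y‖) :=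
    eLpNorm_top_le_of_forall_norm_le hN
  have hdivt : IsWeaklyDivFree (u t) := isWeaklyDivFree_slice_of_oseenMild hν hum hu0 hdiv0 hM hmild ht
  have hwm : AEStronglyMeasurable (uncurry u)
      ((volume : Measure (ℝ × EuclideanSpace ℝ (Fin 3))).restrict (Ioo t T₁ ×ˢ univ)) :=
    hum.mono_measure
      (Measure.restrict_mono (prod_mono (Ioo_subset_Ioo ht.1.le hT₁T) Subset.rfl) le_rfl)
  have hwM : ∀ τ ∈ Ioo t T₁, eLpNorm (u τ) ∞ volume ≤ ENNReal.ofReal M := fun τ hτ =>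
    eLpNorm_top_le_of_forall_norm_le (hM τ ⟨(ht.1.trans hτ.1).le, hτ.2.trans_le hT₁T⟩)
  have hw : ∀ τ ∈ Ioo t T₁, u τ =ᵐ[volume] fun x =>
      UnboundedOperators.heatExtension (u t) (ν * (τ - t)) x - oseenDuhamel ν t u u τ x :=
    fun τ hτ => hrestart hτ.1 (hτ.2.trans_le hT₁T)
  have hwc : ∀ τ ∈ Ioo t T₁, Continuous (u τ) := fun τ hτ =>
    hcont τ ⟨ht.1.trans hτ.1, hτ.2.trans_le hT₁T⟩
  exact hG hν t hNpos ha haN hdivt htT₁ hT₁le hM0 hwm hwM hw hwc s ⟨hs.1, hsT₁⟩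

/-! ### The schema for classical solutions bounded and of finite energy on compact sub-slabs -/

/-- **Grujić 2013, Theorem 3.1 in restart form, for classical solutions regular on `(0, T)`.**
With the same absolute `c₀ > 1`: a classical unforced Navier–Stokes solution `(u, p)` on
`ℝ³ × (0, T)` (the frame of `grujic2013_sparseness_regularity_velocity`) which on every compact
sub-slab `[a, b] × ℝ³`, `0 < a ≤ b < T`, is bounded and of finite energy has the analytic restarts
`Grujic2013.HasAnalyticRestarts c₀ ν T u`. Proof: for `0 < t < s < T` in the window, the
translate `u(· + t)` is a classical solution on `[0, b − t]`, `s < b < T`, bounded and of finite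
energy, hence Oseen-mild from the datum `u(t)` (`IsClassicalNSSolutionOn.ae_eq_forced_oseenMild`
with zero force), its slices are continuous and `u(t)` is weakly divergence free (pointwise
`div u(t) = 0`); Guberović's theorem from the base time gives the tube extension of `u(s)`.
[cite: Grujic2012, Thm. 3.1 and Rmk. 3.1 (arXiv:1111.0217 p. 6), proof of Thm. 4.1 (p. 7); LemarieRieusset2016, Thm. 6.1 with Prop. 6.5] -/
theorem hasAnalyticRestarts_of_classical :
    ∃ c₀ : ℝ, 1 < c₀ ∧ ∀ ⦃ν T : ℝ⦄, 0 < ν → 0 < T →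
      ∀ ⦃u : ℝ → EuclideanSpace ℝ (Fin 3) → EuclideanSpace ℝ (Fin 3)⦄
        ⦃p : ℝ → EuclideanSpace ℝ (Fin 3) → ℝ⦄,
        IsClassicalNSSolutionOn (Ioo 0 T) ν 0 u p →
        (∀ a b : ℝ, 0 < a → a ≤ b → b < T →
          ∃ M : ℝ, ∀ t ∈ Icc a b, ∀ x, ‖u t x‖ ≤ M) →
        (∀ a b : ℝ, 0 < a → a ≤ b → b < T →
          ∃ C : ℝ≥0∞, C < ⊤ ∧ ∀ t ∈ Icc a b, ∫⁻ x, ‖u t x‖ₑ ^ 2 ≤ C) →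
        Grujic2013.HasAnalyticRestarts c₀ ν T u := by
  obtain ⟨c₀, hc₀, hG⟩ := guberovic2010_analyticity_radius_holds.of_oseen_solution
  refine ⟨c₀, hc₀, ?_⟩
  intro ν T hν hT u p hcl hbdd hen t ht s hs hwin
  -- `N = ‖u(t)‖_∞`
  set b : ℝ := (s + T) / 2 with hb
  have hsb : s < b := by rw [hb]; linarith [hs.2]
  have hbT : b < T := by rw [hb]; linarith [hs.2]
  have htb : t < b := hs.1.trans hsb
  obtain ⟨M₀, hM₀⟩ := hbdd t b ht.1 htb.le hbT
  set M : ℝ := max M₀ 1 with hMdef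
  have hMpos : 0 < M := lt_max_of_lt_right one_pos
  have hM : ∀ τ ∈ Icc t b, ∀ x, ‖u τ x‖ ≤ M := fun τ hτ x => (hM₀ τ hτ x).trans (le_max_left _ _)
  have hbddt : BddAbove (Set.range fun x => ‖u t x‖) := by
    refine ⟨M, ?_⟩
    rintro _ ⟨x, rfl⟩
    exact hM t ⟨le_rfl, htb.le⟩ x
  have hN : ∀ x, ‖u t x‖ ≤ ⨆ y, ‖u t y‖ := fun x => le_ciSup hbddt x
  have hN0 : 0 ≤ ⨆ y, ‖u t y‖ := Real.iSup_nonneg fun y => norm_nonneg _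
  rcases hN0.eq_or_lt with hz | hNpos
  · exfalso
    rw [← hz] at hwin
    simp at hwin
    linarith [hs.1]
  -- the translate `v = u(· + t)` on the closed slab `[0, b - t]`
  have hbt : 0 < b - t := sub_pos.2 htb
  set v : ℝ → EuclideanSpace ℝ (Fin 3) → EuclideanSpace ℝ (Fin 3) := fun τ => u (τ + t) with hv
  set q : ℝ → EuclideanSpace ℝ (Fin 3) → ℝ := fun τ => p (τ + t) with hq
  have hclv : IsClassicalNSSolutionOn (Icc 0 (b - t)) ν 0 v q :=
    hcl.translate_Icc_of_Ioo ht.1 hbt (by linarith)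
  have hv0 : v 0 = u t := by simp [hv]
  have hvM : ∀ τ ∈ Icc 0 (b - t), ∀ x, ‖v τ x‖ ≤ M := fun τ hτ x =>
    hM (τ + t) ⟨by linarith [hτ.1], by linarith [hτ.2]⟩ x
  have hvE : ∃ C : ℝ≥0∞, C < ⊤ ∧ ∀ τ ∈ Icc 0 (b - t), ∫⁻ x, ‖v τ x‖ₑ ^ 2 ≤ C := by
    obtain ⟨C, hC, hCb⟩ := hen t b ht.1 htb.le hbT
    exact ⟨C, hC, fun τ hτ => hCb (τ + t) ⟨by linarith [hτ.1], by linarith [hτ.2]⟩⟩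
  -- Oseen-mild from the datum `v 0 = u t` (zero force)
  have hmild : ∀ τ ∈ Ioc 0 (b - t), v τ =ᵐ[volume] fun x =>
      UnboundedOperators.heatExtension (v 0) (ν * τ) x - oseenDuhamel ν 0 v v τ x := by
    intro τ hτ
    have hg0 : ∀ τ' ∈ Icc 0 (b - t), ∀ y : EuclideanSpace ℝ (Fin 3),
        ‖(0 : ℝ → EuclideanSpace ℝ (Fin 3) → EuclideanSpace ℝ (Fin 3)) τ' y‖ ≤ 0 := by
      intro τ' _ y
      simp
    have h := hclv.ae_eq_forced_oseenMild hν hbt (g := 0) (G := 0) continuous_const hg0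
      (fun τ' _ => fun θ _ => by simp) (G₂ := 0) ENNReal.zero_ne_top
      (fun τ' _ => by simp) hvE hMpos hvM hτ
    have hF : ∀ x, forceDuhamel ν 0 (0 : ℝ → EuclideanSpace ℝ (Fin 3) → EuclideanSpace ℝ (Fin 3)) τ x
        = 0 := by
      intro x
      have h1 := norm_forceDuhamel_le (g := (0 : ℝ → EuclideanSpace ℝ (Fin 3) →
        EuclideanSpace ℝ (Fin 3))) (G := 0) hν hτ.1.le (fun τ' _ y => by simp) x
      rw [mul_zero] at h1
      exact norm_le_zero_iff.1 h1
    filter_upwards [h] with x hx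
    rw [hx, hF x, add_zero]
  -- hypotheses of Guberović's theorem on `(0, T₁)`, `T₁ = min (b - t) (ν/(c₀² N²))`
  set T₁ : ℝ := min (b - t) (ν / (c₀ ^ 2 * (⨆ y, ‖u t y‖) ^ 2)) with hT₁
  have hsT₁ : s - t < T₁ := lt_min (by linarith) (by linarith)
  have hT₁pos : 0 < T₁ := (sub_pos.2 hs.1).trans hsT₁
  have hT₁le : T₁ ≤ 0 + ν / (c₀ ^ 2 * (⨆ y, ‖u t y‖) ^ 2) := by
    rw [zero_add]
    exact min_le_right _ _
  have hT₁b : T₁ ≤ b - t := min_le_left _ _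
  have hcontv : ∀ τ ∈ Icc 0 (b - t), Continuous (v τ) := fun τ hτ =>
    (hclv.contDiff_velocity hτ).continuous
  have ha : AEStronglyMeasurable (u t) volume := by
    rw [← hv0]
    exact (hcontv 0 ⟨le_rfl, hbt.le⟩).aestronglyMeasurable
  have haN : eLpNorm (u t) ∞ volume ≤ ENNReal.ofReal (⨆ y, ‖u t y‖) :=
    eLpNorm_top_le_of_forall_norm_le hN
  have hdivt : IsWeaklyDivFree (u t) :=
    VectorCalculus.IsDivFree.isWeaklyDivFree_holds (hcl.divFree t ht)
      ((hcl.contDiff_velocity ht).of_le (by norm_cast))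
  have hwm : AEStronglyMeasurable (uncurry v)
      ((volume : Measure (ℝ × EuclideanSpace ℝ (Fin 3))).restrict (Ioo 0 T₁ ×ˢ univ)) :=
    (hclv.smooth_velocity.continuousOn.mono
      (prod_mono (fun τ hτ => ⟨hτ.1.le, hτ.2.le.trans hT₁b⟩) Subset.rfl)).aestronglyMeasurable
      (measurableSet_Ioo.prod MeasurableSet.univ)
  have hwM : ∀ τ ∈ Ioo 0 T₁, eLpNorm (v τ) ∞ volume ≤ ENNReal.ofReal M := fun τ hτ =>
    eLpNorm_top_le_of_forall_norm_le (hvM τ ⟨hτ.1.le, hτ.2.le.trans hT₁b⟩)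
  have hw : ∀ τ ∈ Ioo 0 T₁, v τ =ᵐ[volume] fun x =>
      UnboundedOperators.heatExtension (u t) (ν * (τ - 0)) x - oseenDuhamel ν 0 v v τ x := by
    intro τ hτ
    rw [sub_zero, ← hv0]
    exact hmild τ ⟨hτ.1, hτ.2.le.trans hT₁b⟩
  have hwc : ∀ τ ∈ Ioo 0 T₁, Continuous (v τ) := fun τ hτ =>
    hcontv τ ⟨hτ.1.le, hτ.2.le.trans hT₁b⟩
  obtain ⟨U, hUd, hUv, hUb⟩ :=
    hG hν 0 hNpos ha haN hdivt hT₁pos hT₁le hMpos.le hwm hwM hw hwc (s - t) ⟨sub_pos.2 hs.1, hsT₁⟩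
  refine ⟨U, ?_, fun x => ?_, ?_⟩
  · simpa only [sub_zero] using hUd
  · rw [hUv x, hv]
    simp only [sub_add_cancel]
  · simpa only [sub_zero] using hUb

end Grujic2013

end Literature.Analysis.FluidPDE

end
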